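import Mathlib
import Summits.PneNP.PneNP.Theorems.Nc03AvoidResidualCoreReductionGlue
import Literature.Computability.Complexity.CodeFPArith
import Literature.Computability.Complexity.CodeFPListKit

/-!
# Route Nc03AvoidResidualCore, item `ResidualCoreReduction` — the solver, III: kit for class solvers

Helper file for `stmt-PneNP-20227` (sequel of `…ReductionGlue`; cell pnp-ideate). Shared vocabulary
of the per-class solvers, which receive a raw pure instance `pr = rawOf J = (N, M, triples)` and
return a list of `M` bits:

* codes: `tripE`, `prE` (`N, M` in unary, the variable triples in binary), `etE` for enumerated
  triples `(index, triple)`; `enumT pr` — the triples with their output indices (`codeFP_enumT`);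
* `indic M S` — the indicator list of a list of indices (`codeFP_indic`, `getD_indic`);
* reading lemmas: members of `enumT (rawOf J)` are the pairs `(p, tripOf J p)` (`mem_enumT_iff`),
  equal coordinates of triples are equal variables (`vars_eq_of_val_eq`);
* generic search plumbing: `codeFP_searchIndic` — "find the first tuple of a candidate list passing
  a test and output the indicator of a set of indices read off it" is polynomial time when the
  candidates, the test and the read-off are.
-/

set_option linter.dupNamespace false -- `Summit.PneNP.PneNP.…`: summit = sub-problem name (D-0017 single-conjunct layout)

namespace Summit.PneNP.PneNP.Theorems.Nc03Reduction

open Literature.Computability.Complexity CodeFP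

/-! ## Codes -/

/-- The code of a variable triple. -/
abbrev tripE : ℕ × ℕ × ℕ → List Bool := pairE natE (pairE natE natE)

/-- The code of a raw pure instance: `N, M` in unary, the triples in binary. -/
def prE : PRaw → List Bool := pairE unE (pairE unE (rawE tripE))

/-- An enumerated triple: `(output index, variable triple)`. -/
abbrev ETrip := ℕ × (ℕ × ℕ × ℕ)

/-- The code of an enumerated triple. -/
abbrev etE : ETrip → List Bool := pairE natE tripE

/-- `tripE` is injective. -/
theorem tripE_injective : Function.Injective tripE :=
  pairE_injective natE_injective (pairE_injective natE_injective natE_injective)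

/-- `etE` is injective. -/
theorem etE_injective : Function.Injective etE := pairE_injective natE_injective tripE_injective

/-- The triples of a raw pure instance with their output indices. -/
def enumT (pr : PRaw) : List ETrip := (List.range pr.2.2.length).zip pr.2.2

/-- The number of outputs of a raw pure instance. -/
theorem codeFP_M : CodeFP prE unE (fun pr : PRaw => pr.2.1) := (snd _ _).fst'

/-- The number of variables of a raw pure instance. -/
theorem codeFP_N : CodeFP prE unE (fun pr : PRaw => pr.1) := fst _ _

/-- The triples of a raw pure instance. -/
theorem codeFP_trips : CodeFP prE (rawE tripE) (fun pr : PRaw => pr.2.2) := (snd _ _).snd'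

/-- Enumerating the triples is polynomial time. -/
theorem codeFP_enumT : CodeFP prE (rawE etE) enumT := (rawEnum tripE).comp codeFP_trips

/-! ## Indicator lists -/

/-- The indicator list of length `M` of a list of indices. -/
def indic (M : ℕ) (S : List ℕ) : List Bool := (List.range M).map fun i => decide (i ∈ S)

/-- The indicator list has length `M`. -/
@[simp] theorem length_indic (M : ℕ) (S : List ℕ) : (indic M S).length = M := by simp [indic]

/-- Reading the indicator list. -/
theorem getD_indic {M : ℕ} (S : List ℕ) {i : ℕ} (hi : i < M) :
    (indic M S).getD i false = decide (i ∈ S) := by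
  unfold indic
  rw [List.getD_eq_getElem?_getD, List.getElem?_map, List.getElem?_range hi]
  rfl

/-- The indicator list is polynomial time. -/
theorem codeFP_indic : CodeFP (pairE unE (rawE natE)) (rawE bitE) (fun p => indic p.1 p.2) := by
  have hm : CodeFP (pairE (rawE natE) natE) bitE (fun q => decide (q.2 ∈ q.1)) :=
    (mem natE_injective).comp ((snd _ _).pair (fst _ _))
  exact ((map hm).comp ((snd _ _).pair (urange.comp (fst _ _)))).congr fun _ => rfl

/-! ## Reading raw pure instances -/

section Reading

variable {N M : ℕ} (J : LocalMap 3 N M)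

/-- The variable triple of an output. -/
def tripOf (p : Fin M) : ℕ × ℕ × ℕ := ((J.vars p 0).val, (J.vars p 1).val, (J.vars p 2).val)

/-- The raw form, spelled with `tripOf`. -/
theorem rawOf_eq : rawOf J = (N, M, List.ofFn (tripOf J)) := rfl

/-- Members of the enumeration are the pairs `(p, tripOf J p)`. -/
theorem mem_enumT_iff {q : ETrip} : q ∈ enumT (rawOf J) ↔ ∃ p : Fin M, q = (p.val, tripOf J p) := by
  unfold enumT
  rw [rawOf_eq]
  simp only [List.length_ofFn]
  constructor
  · intro hq
    obtain ⟨i, hi, hget⟩ := List.getElem_of_mem hq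
    rw [List.length_zip, List.length_range, List.length_ofFn, min_self] at hi
    refine ⟨⟨i, hi⟩, ?_⟩
    rw [← hget, List.getElem_zip, List.getElem_range, List.getElem_ofFn]
  · rintro ⟨p, rfl⟩
    have hp : p.val < ((List.range M).zip (List.ofFn (tripOf J))).length := by
      rw [List.length_zip, List.length_range, List.length_ofFn, min_self]; exact p.isLt
    have := List.getElem_mem hp
    rwa [List.getElem_zip, List.getElem_range, List.getElem_ofFn] at this

/-- Each output appears in the enumeration. -/
theorem mem_enumT (p : Fin M) : (p.val, tripOf J p) ∈ enumT (rawOf J) :=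
  (mem_enumT_iff J).2 ⟨p, rfl⟩

/-- Equal coordinates are equal variables. -/
theorem vars_eq_of_val_eq {p p' : Fin M} {r r' : Fin 3} (h : (J.vars p r).val = (J.vars p' r').val) :
    J.vars p r = J.vars p' r' := Fin.ext h

/-- Role-`0` coordinate of `tripOf`. -/
@[simp] theorem tripOf_fst (p : Fin M) : (tripOf J p).1 = (J.vars p 0).val := rfl
/-- Role-`1` coordinate of `tripOf`. -/
@[simp] theorem tripOf_snd_fst (p : Fin M) : (tripOf J p).2.1 = (J.vars p 1).val := rfl
/-- Role-`2` coordinate of `tripOf`. -/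
@[simp] theorem tripOf_snd_snd (p : Fin M) : (tripOf J p).2.2 = (J.vars p 2).val := rfl

/-- The number of outputs read off the raw form. -/
@[simp] theorem rawOf_M : (rawOf J).2.1 = M := rfl

/-- The number of variables read off the raw form. -/
@[simp] theorem rawOf_N : (rawOf J).1 = N := rfl

/-- Reading an indicator pattern at an output. -/
theorem indic_at (S : List ℕ) (p : Fin M) : (indic M S).getD p.val false = decide (p.val ∈ S) :=
  getD_indic S p.isLt

end Reading

/-! ## Search plumbing -/

variable {α : Type}

/-- **Search-and-indicate is polynomial time**: from a raw pure instance, list candidates, find the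
first passing a test, and output the indicator (of length `M`) of indices read off the witness
(or of nothing). -/
theorem codeFP_searchIndic {eα : α → List Bool} {cands : PRaw → List α} {test : α → Bool}
    {readOff : α → List ℕ} (hc : CodeFP prE (rawE eα) cands) (ht : CodeFP eα bitE test)
    (hr : CodeFP eα (rawE natE) readOff) :
    CodeFP prE (rawE bitE) (fun pr => match (cands pr).find? test with
      | none => indic pr.2.1 []
      | some x => indic pr.2.1 (readOff x)) := by
  have hfind : CodeFP prE (optE eα) (fun pr => (cands pr).find? test) :=
    ((rawFind? (σ := Unit) (eσ := unitE) (p := fun q => test q.2) (ht.comp (snd _ _))).comp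
      ((const prE ()).pair hc)).congr fun _ => rfl
  have hk := optCases (σ := PRaw) (eσ := prE) (eα := eα) (eδ := rawE bitE)
    (k := fun pr o => match o with | none => indic pr.2.1 [] | some x => indic pr.2.1 (readOff x))
    (gnone := fun pr => indic pr.2.1 []) (gsome := fun t => indic t.1.2.1 (readOff t.2))
    (codeFP_indic.comp (codeFP_M.pair (const prE ([] : List ℕ))))
    (codeFP_indic.comp ((codeFP_M.comp (fst _ _)).pair (hr.comp (snd _ _))))
    (fun _ => rfl) (fun _ _ => rfl)
  exact (hk.comp ((CodeFP.id prE).pair hfind)).congr fun _ => rfl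

/-- Equality test on two natural-number read-offs. -/
theorem codeFP_eqTest {eα : α → List Bool} {f g : α → ℕ} (hf : CodeFP eα natE f) (hg : CodeFP eα natE g) :
    CodeFP eα bitE (fun a => decide (f a = g a)) :=
  (natEq.comp (hf.pair hg)).congr fun _ => rfl

/-! ## Search output through one shared `Option` eliminator -/

/-- The output of a search: the indicator of the found index list, or of nothing. (One shared
eliminator, so that solver programs and the generic lemma agree syntactically.) -/
def searchOut (M : ℕ) (o : Option (List ℕ)) : List Bool :=
  match o with
  | none => indic M []
  | some S => indic M S

/-- The search output has length `M`. -/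
@[simp] theorem length_searchOut (M : ℕ) (o : Option (List ℕ)) : (searchOut M o).length = M := by
  unfold searchOut; split <;> simp

/-- The search output on a hit. -/
theorem searchOut_some (M : ℕ) (S : List ℕ) : searchOut M (some S) = indic M S := rfl

/-- **Search-and-indicate is polynomial time** (shared-eliminator form): list candidates, find the
first passing a test, read an index list off the witness, output its indicator of length `M`. -/
theorem codeFP_searchOut {eα : α → List Bool} {cands : PRaw → List α} {test : α → Bool}
    {readOff : α → List ℕ} (hc : CodeFP prE (rawE eα) cands) (ht : CodeFP eα bitE test)
    (hr : CodeFP eα (rawE natE) readOff) :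
    CodeFP prE (rawE bitE) (fun pr => searchOut pr.2.1 (((cands pr).find? test).map readOff)) := by
  have hfind : CodeFP prE (optE eα) (fun pr => (cands pr).find? test) :=
    ((rawFind? (σ := Unit) (eσ := unitE) (p := fun q => test q.2) (ht.comp (snd _ _))).comp
      ((const prE ()).pair hc)).congr fun _ => rfl
  have hmap : CodeFP prE (optE (rawE natE)) (fun pr => ((cands pr).find? test).map readOff) :=
    ((optMap (σ := Unit) (eσ := unitE) (g := fun q => readOff q.2) (hr.comp (snd _ _))).comp
      ((const prE ()).pair hfind)).congr fun _ => rfl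
  have hk := optCases (σ := PRaw) (eσ := prE) (eα := rawE natE) (eδ := rawE bitE)
    (k := fun pr o => searchOut pr.2.1 o)
    (gnone := fun pr => indic pr.2.1 []) (gsome := fun t => indic t.1.2.1 t.2)
    (codeFP_indic.comp (codeFP_M.pair (const prE ([] : List ℕ))))
    (codeFP_indic.comp ((codeFP_M.comp (fst _ _)).pair (snd _ _)))
    (fun _ => rfl) (fun _ _ => rfl)
  exact (hk.comp ((CodeFP.id prE).pair hmap)).congr fun _ => rfl

end Summit.PneNP.PneNP.Theorems.Nc03Reduction
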